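/-
Copyright (c) 2026 the pub-hodgecm-mathlib formalisation cell (harness21).  Prover seat hodgecm-mathlib-K2E3-p34 (g2), Track B «K2-LIT», engine E3, unit U4 «Keys»; PART
«U4Keys» socket :182 (U4f-χ₁-ram-one-pos), programme A_pos^{<} (Roche regime cond_F χ₁ = k+1 ≤ m+1 = cond_E χ₁), brick (B3) file 2 «THE TWO LETTERS OF THE TWO-DEPTH
ASSEMBLY, DISCHARGED: the sharp big cell `hsharp` and the shell witnesses `hshell`» (CM dresses of ★ p862537 and of ★ p862772 ∕ ★ p862799 + ★ p862750∕p862901);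
dealer K2E3-plan (g5), K2 bus 2026-09-04T23:08Z.  KERNEL module: THEOREMS ONLY (no definition, no named fact, no `sorry`, no instance, no notation).
-/
import Summits.HodgeConjecture.HodgeConjecture.Theorems.K2E3LowerUnipotentDeepCellCM          -- ★ p862590 (this seat): `symm_mem_comap_of_mem`, the pull-back pattern; brings ★ p862537 `exists_borel_mul_weylLongU_mul_mem_of_v_apply_div_le`, ★ (c1) `map_weylConj_mem_map`
import Summits.HodgeConjecture.HodgeConjecture.Theorems.K2E3TwoDepthDepthWitnessCM           -- ★ p862772 (K2E3-p37 g2): `exists_depthWitness_twoDepth_of_mem_map_of_not_mem` (the LOWER shells `|z| ≤ 1`)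
import Summits.HodgeConjecture.HodgeConjecture.Theorems.K2E3TwoDepthUpperShellCover          -- ★ p862799 (K2E3-p37 g2): `exists_upperShell_witness_package`, `twoDepth_rev_apply` (the UPPER shells `|z| > 1`, model)
import Summits.HodgeConjecture.HodgeConjecture.Theorems.K2E3TwoDepthUpperShellWitnessCM      -- ★ p862750 ∕ p862901 (this seat): `exists_upperShellWitness_of_model_of_unit` (the UPPER shells, CM dress through ★ p862617)
import HarnessLib

/-!
# K2 ∕ E3 «EllipticInputs», unit U4 «Keys» — (U4f-χ₁-ram-one-pos), (B3) file 2: THE LETTERS `hsharp` AND `hshell` OF THE TWO-DEPTH BRANCH-A ASSEMBLY, DISCHARGED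
# «the sharp big cell `|x∕z| ≤ |ϖ|^{r₁}`, `|z| ≥ |ϖ|^{-s₁}` lies in `P·w₀·J_e`; every other representative off `J_e` carries a depth witness»  [Roche1998 §3–§4; Casselman1995 §6.3]

Cell hodgecm-mathlib, Track B «K2-LIT», engine E3, crux item H413 = `stmt-HodgeConjecture-24833` (route `HCCMUnconditional`); line `K2_E3_EllipticInputs`, PART «U4Keys»
socket :182 `sig_K2E3KeysThmTwoContractingRamifiedCharOnePosDepth`, regime A_pos^{<} (memos `K2/K2E3-p37/g0/CENSUS-U4f-PosDepth…md` §9, `K2/K2E3-p34/g2/CENSUS-Apos-lt-shells.md`,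
`K2/K2E3-p37/g2/MEMO-PosA-Recut…md`).  `--supports stmt-HodgeConjecture-24833 --as helper`; THEOREMS ONLY; NOT the :182 payer (the two letters of the hypothesis-first assembly
`K2E3BranchAIrreducibleTwoDepth.false_of_reducible_of_twoDepth`, file 1, are produced here; file 3 plugs them in; the socket re-cut is the dealer's ED. 9).

THE POINT.  The cell family of the two-depth assembly (file 1) is `N = ⋃ cells` with three kinds of representatives: `w₀ n w₀ ∈ J_e`; the SHARP big cell — in the place
model `eA(w₀ n w₀) = ū(x, z)` with `|x∕z| ≤ |ϖ|^{r₁}` and `|z| ≥ |ϖ|^{-s₁}` — which lies in `P·w₀·J_e` (★ p862537 `exists_borel_mul_weylLongU_mul_mem_of_v_apply_div_le` pulled back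
along `eA` exactly as ★ p862590: §1); and the SHELLS `r = w₀ n w₀ ∉ J_e` off the sharp cell, each its own representative, which need a depth witness `b₀ ∈ J_e`, `r b₀ r⁻¹ ∈ P`,
`θ(b₀) ≠ τ(r b₀ r⁻¹)·1` (§2): on the LOWER shells `|z| ≤ 1` this is ★ p862772 verbatim; on the UPPER shells `|z| > 1` the integral point `ū′ = ū(x∕z, z⁻¹)` (★ `exists_coe_eq_lower`,
★ `div_rel`) receives the witness package of ★ p862799 in the SWAPPED group `J_{e^w}` (★ D174 `exists_subgroup_forall_mem_iff_twoDepth` at `(r₂, s₂; r₁, s₁)`, read through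
★ `twoDepth_rev_apply`), with constants `c₁ := σ_w((u₁)_w) − 1 ∈ 𝔭ᵐ` (so that `σ_w(1 + c₁) = (u₁)_w`) and `c₂ := (u₂)_w − 1 ∈ 𝔭ᵏ` (`σ`-fixed), and ★ p862901
`exists_upperShellWitness_of_model_of_unit` transports it to `r` (`u₁` resp. `u₂` as the unit).  Letters as ★ p862772: `1 ≤ m`, `k ≤ m`, `r₁ + r₂ = m + 1`, `s₁ + s₂ = k + 1`,
`|r₁ − r₂| ≤ 1`, `|s₁ − s₂| ≤ 1`, aligned, and the N̄-side exponents positive (`1 ≤ r₂`, `1 ≤ s₂`, which give Roche's concavity at the swapped tuple).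
* §1 **`exists_eq_borel_mul_weyl_mul_mem_of_sharp`** — the letter `hsharp`.
* §2 **`exists_shellWitness_of_mem_map_of_not_mem`** — the letter `hshell`.
HONEST LABEL: HC_CM is proved only modulo the 7 printed citations (2 remaining named inputs: hLiu418 = stmt-HodgeConjecture-24832, h413 = stmt-HodgeConjecture-24833) until
rung 0 closes; count-neutral — the leaf :182 stays OPEN.

## References
* [Roche1998] A. Roche, *Types and Hecke algebras for principal series representations of split reductive p-adic groups*, Ann. Sci. ÉNS (4) 31 (1998), §3–§4.
* [Casselman1995] W. Casselman, *Introduction to the theory of admissible representations of `p`-adic reductive groups* (1995), Prop. 1.3.1, §6.3.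
* [BruhatTits1972] F. Bruhat, J. Tits, *Groupes réductifs sur un corps local I*, Publ. Math. IHÉS 41 (1972), (4.4.4), (6.4.9).
* [Rogawski1990] J. Rogawski, *Automorphic representations of unitary groups in three variables*, Ann. of Math. Stud. 123 (1990), §1.10 p. 9, §12.1 p. 171.
* [Serre1979] J.-P. Serre, *Local Fields*, GTM 67 (1979), Ch. II §1.
-/

set_option autoImplicit false
-- the mandated namespace has the single-problem summit's repeated segment (`HodgeConjecture.HodgeConjecture`)
set_option linter.dupNamespace false

noncomputable section

open NumberField IsDedekindDomain
open scoped Matrix MatrixGroups WithZero Valued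
open Literature.NumberTheory Literature.NumberTheory.Automorphic Literature.NumberTheory.Automorphic.UnitaryGroup
open Literature.NumberTheory.Rogawski1990

namespace Summit.HodgeConjecture.HodgeConjecture.Cruxes.H413.K2E3BranchAIrreducibleTwoDepthCells

open Summit.HodgeConjecture.HodgeConjecture.Cruxes.H413
open Summit.HodgeConjecture.HodgeConjecture.Cruxes.H413.K2E3DepthZeroIwahoriCharacterCM
open Summit.HodgeConjecture.HodgeConjecture.Cruxes.H413.K2E3BranchALettersCM
open Summit.HodgeConjecture.HodgeConjecture.Cruxes.H413.K2E3BranchATorusWitnessCM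
open Summit.HodgeConjecture.HodgeConjecture.Cruxes.H413.K2E3LevelNDepthWitnessCM

variable (L : Type) [Field L] [NumberField L] [IsCMField L] (v : HeightOneSpectrum (𝓞 ↥(maximalRealSubfield L)))
  (w : PlacesOver L v) (hw : IsCMField.complexConj L • w.1 = w.1)
  (eA : Gqs L v ≃ₜ* ↥(unitaryGroupOfForm (galAdicCompletionMap (L := L) (IsCMField.complexConj L) hw) ((StdForm.antidiagonal 3).over (w.1.adicCompletion L))))
  (heA : ∀ g : Gqs L v,
    ((eA g : ↥(unitaryGroupOfForm (galAdicCompletionMap (L := L) (IsCMField.complexConj L) hw) ((StdForm.antidiagonal 3).over (w.1.adicCompletion L)))) :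
        GL (Fin 3) (w.1.adicCompletion L)) =
      ((localNonsplitEquiv (IsCMField.complexConj L) (qsForm L) (IsCMField.complexConj_ne_one L) w hw g :
        ↥(unitaryGroupOfForm (galAdicCompletionMap (L := L) (IsCMField.complexConj L) hw) (placeForm (qsForm L) w.1))) : GL (Fin 3) (w.1.adicCompletion L)))
  {ϖ : w.1.adicCompletion L} (hϖ : Valued.v ϖ = WithZero.exp (-1 : ℤ))
  (r₁ s₁ r₂ s₂ : ℕ) (Jg : Subgroup ↥(unitaryGroupOfForm (galAdicCompletionMap (L := L) (IsCMField.complexConj L) hw) ((StdForm.antidiagonal 3).over (w.1.adicCompletion L))))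
  (hJg : ∀ k : ↥(unitaryGroupOfForm (galAdicCompletionMap (L := L) (IsCMField.complexConj L) hw) ((StdForm.antidiagonal 3).over (w.1.adicCompletion L))),
    k ∈ Jg ↔ ∀ i j, Valued.v (((k : GL (Fin 3) (w.1.adicCompletion L)) : Matrix (Fin 3) (Fin 3) (w.1.adicCompletion L)) i j) ≤
      Valued.v ϖ ^ (![![0, r₁, s₁], ![r₂, 0, r₁], ![s₂, r₂, 0]] : Fin 3 → Fin 3 → ℕ) i j)
  (Je : Subgroup (Gqs L v)) (hJe : Je = Jg.comap eA.toMulEquiv.toMonoidHom)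
  (w₀ : Gqs L v) (hw₀ : Units.val (w₀.val : GL (Fin 3) (LocalRing L v)) = cmLocalForm L 3 v)

/-! ## §1 The letter `hsharp`: the sharp big cell lies in `P · w₀ · J_e` -/

include hw heA hϖ hJg hJe hw₀ in
/-- **THE SHARP BIG CELL FOR THE TWO-DEPTH GROUP (CM), entry form = the letter `hsharp` of the assembly.**  For `n ∈ N` with `|(eA(w₀ n w₀))₂₁ ∕ (eA(w₀ n w₀))₂₀| ≤ |ϖ|^{r₁}`
and `|(eA(w₀ n w₀))₂₀| ≥ |ϖ|^{-s₁}`: `w₀ n w₀ = h · w₀ · b′` with `h ∈ P`, `b′ ∈ J_e`.  ★ p862537 `exists_borel_mul_weylLongU_mul_mem_of_v_apply_div_le` on the place model (`e 0 1 = r₁`,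
`e 0 2 = s₁`; `eA(w₀ n w₀) ∈ N̄_w` ★ (c1) `map_weylConj_mem_map`) pulled back along `eA` as in ★ p862590 (`eA⁻¹ p ∈ P` ★ `symm_mem_P_of_mem_borelU`, `eA⁻¹ u ∈ J_e`
★ `symm_mem_comap_of_mem`, `eA w₀ = w`). [cite: Casselman1995, Prop. 1.3.1] [cite: BruhatTits1972, (4.4.4), (6.4.9)] [cite: Roche1998, §3–§4] [cite: Rogawski1990, §1.10 p. 9] -/
theorem exists_eq_borel_mul_weyl_mul_mem_of_sharp (t : ParabolicTriple (Gqs L v)) (ht : t = cmBorelTriple L 3 v) {n : Gqs L v} (hn : n ∈ t.N)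
    (hs : Valued.v ((((eA (w₀ * n * w₀) :
        ↥(unitaryGroupOfForm (galAdicCompletionMap (L := L) (IsCMField.complexConj L) hw) ((StdForm.antidiagonal 3).over (w.1.adicCompletion L)))) :
          GL (Fin 3) (w.1.adicCompletion L)) : Matrix (Fin 3) (Fin 3) (w.1.adicCompletion L)) 2 1 /
        (((eA (w₀ * n * w₀) :
        ↥(unitaryGroupOfForm (galAdicCompletionMap (L := L) (IsCMField.complexConj L) hw) ((StdForm.antidiagonal 3).over (w.1.adicCompletion L)))) :
          GL (Fin 3) (w.1.adicCompletion L)) : Matrix (Fin 3) (Fin 3) (w.1.adicCompletion L)) 2 0) ≤ Valued.v ϖ ^ r₁ ∧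
      (Valued.v ϖ ^ s₁)⁻¹ ≤ Valued.v ((((eA (w₀ * n * w₀) :
        ↥(unitaryGroupOfForm (galAdicCompletionMap (L := L) (IsCMField.complexConj L) hw) ((StdForm.antidiagonal 3).over (w.1.adicCompletion L)))) :
          GL (Fin 3) (w.1.adicCompletion L)) : Matrix (Fin 3) (Fin 3) (w.1.adicCompletion L)) 2 0)) :
    ∃ h ∈ t.P, ∃ b' ∈ Je, w₀ * n * w₀ = h * w₀ * b' := by
  have hσσ : ∀ x, (galAdicCompletionMap (L := L) (IsCMField.complexConj L) hw) ((galAdicCompletionMap (L := L) (IsCMField.complexConj L) hw) x) = x :=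
    galAdicCompletionMap_galAdicCompletionMap_of_smul_eq (IsCMField.complexConj L) w (IsCMField.complexConj_ne_one L) hw
  have hvσ : ∀ x, Valued.v (galAdicCompletionMap (L := L) (IsCMField.complexConj L) hw x) = Valued.v x :=
    fun x => valued_galAdicCompletionMap (L := L) (IsCMField.complexConj L) hw x
  have he0 : ∀ i : Fin 3, (![![0, r₁, s₁], ![r₂, 0, r₁], ![s₂, r₂, 0]] : Fin 3 → Fin 3 → ℕ) i i = 0 := fun i => by
    fin_cases i <;> rfl
  have hwL := map_weyl_eq_weylLongU L v w hw eA heA w₀ hw₀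
  obtain ⟨p, hp, u, hu, heq⟩ := K2E3LowerUnipotentDeepCellTwoDepth.exists_borel_mul_weylLongU_mul_mem_of_v_apply_div_le
    (galAdicCompletionMap (L := L) (IsCMField.complexConj L) hw) (rfl : (StdForm.antidiagonal 3).over (w.1.adicCompletion L) = _) hσσ hvσ hϖ _ Jg hJg he0
    (K2E3IwahoriTwoDepthFactorisation.twoDepth_symm r₁ s₁ r₂ s₂)
    (K2E3LowerUnipotentBigCellCM.map_weylConj_mem_map L v w hw eA heA t ht w₀ hw₀ hn) hs.1 hs.2
  refine ⟨eA.symm p, symm_mem_P_of_mem_borelU L v w hw eA heA t ht hp, eA.symm u,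
    K2E3LowerUnipotentDeepCellCM.symm_mem_comap_of_mem L v w hw eA Jg Je hJe hu, ?_⟩
  apply eA.injective
  rw [heq, map_mul, map_mul, ContinuousMulEquiv.apply_symm_apply, ContinuousMulEquiv.apply_symm_apply, hwL]

/-! ## §2 The letter `hshell`: a depth witness on every shell representative -/

open Classical in
include hw heA hϖ hJg hJe hw₀ in
set_option maxHeartbeats 1600000 in
-- class of ★ p862772 (`K2E3TwoDepthDepthWitnessCM`, 1600000): the `U(Φ₃)(L⁺_v)`-valued products are read in two definitionally equal carriers; unification is slow
/-- **THE LETTER `hshell` OF THE TWO-DEPTH ASSEMBLY (CM).**  Frame and letters as in the module docstring (exponents `r₁ + r₂ = m + 1`, `s₁ + s₂ = k + 1`, `k ≤ m`, `1 ≤ m`,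
`|r₁ − r₂| ≤ 1`, `|s₁ − s₂| ≤ 1`, aligned, `1 ≤ r₂`, `1 ≤ s₂`; a trace-one `t`; `hcond` at `m + 1`; the E-witness `u₁` (`|(u₁)_{w′} − 1| ≤ |ϖ|ᵐ`, `χ₁ u₁ ≠ 1`) and the F-witness
`u₂` (`σ`-fixed, `|(u₂)_{w′} − 1| ≤ |ϖ|ᵏ`, `χ₁ u₂ ≠ 1`)).  For every `r ∈ N̄ = N.map (conj w₀)` with `r ∉ J_e` and `eA r` OFF the sharp big cell there is `b₀ ∈ J_e` with
`r b₀ r⁻¹ ∈ P` and `θ(b₀) ≠ (((1 ⊗ (χ₁, 1)) ∘ proj) ⊗ δ^{1∕2})(r b₀ r⁻¹)·1` (`θ(g) = if IsUnit g₀₀ then χ₁(unit g₀₀) else 0`).  LOWER shells `|(eA r)₂₀| ≤ 1`: ★ p862772.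
UPPER shells `|(eA r)₂₀| > 1`: `eA r = ū(x, z)` (★ `exists_coe_eq_lower_of_mem_map`), `r ∉ J_e` in entry form for free (`|z| > 1 ≥ |ϖ|^{s₂}`), the integral point `ū(x∕z, z⁻¹)`
(★ `exists_coe_eq_lower`, ★ `div_rel`), the swapped group `J_{e^w}` (★ `exists_subgroup_forall_mem_iff_twoDepth` at `(r₂, s₂; r₁, s₁)`, ★ `twoDepth_rev_apply`), the package
★ p862799 with `c₁ := σ_w((u₁)_w) − 1`, `c₂ := (u₂)_w − 1`, and ★ p862901 `exists_upperShellWitness_of_model_of_unit` with the unit `u₁` resp. `u₂`.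
[cite: Roche1998, §3–§4] [cite: Casselman1995, §6.3] [cite: Rogawski1990, §1.10 p. 9] [cite: Rogawski1990, §12.1 p. 171] [cite: BruhatTits1972, (6.4.9)] [cite: Serre1979, Ch. II §1] -/
theorem exists_shellWitness_of_mem_map_of_not_mem {m k : ℕ} (hm : 1 ≤ m) (hkm : k ≤ m) (hrr : r₁ + r₂ = m + 1) (hss : s₁ + s₂ = k + 1)
    (hr1 : r₁ ≤ r₂ + 1) (hr2 : r₂ ≤ r₁ + 1) (hs1 : s₁ ≤ s₂ + 1) (hs2 : s₂ ≤ s₁ + 1) (hal : (r₁ ≤ r₂ ∧ s₁ ≤ s₂) ∨ (r₂ ≤ r₁ ∧ s₂ ≤ s₁))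
    (h10 : 1 ≤ r₂) (h20 : 1 ≤ s₂)
    {t : w.1.adicCompletion L} (ht : t + galAdicCompletionMap (L := L) (IsCMField.complexConj L) hw t = 1) (hvt : Valued.v t ≤ 1)
    (χ₁ : (LocalRing L v)ˣ →* ℂˣ)
    (hcond : ∀ u : (LocalRing L v)ˣ, (∀ w' : PlacesOver L v, Valued.v (((u : LocalRing L v) w') - 1) ≤ Valued.v ϖ ^ (m + 1)) → χ₁ u = 1)
    (u₁ : (LocalRing L v)ˣ) (hu₁ : ∀ w' : PlacesOver L v, Valued.v (((u₁ : LocalRing L v) w') - 1) ≤ Valued.v ϖ ^ m) (hχu₁ : χ₁ u₁ ≠ 1)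
    (u₂ : (LocalRing L v)ˣ) (hσu₂ : Units.map (conjLocal L (IsCMField.complexConj L) v : LocalRing L v →* LocalRing L v) u₂ = u₂)
    (hu₂ : ∀ w' : PlacesOver L v, Valued.v (((u₂ : LocalRing L v) w') - 1) ≤ Valued.v ϖ ^ k) (hχu₂ : χ₁ u₂ ≠ 1)
    {r : Gqs L v} (hr : r ∈ ((cmBorelTriple L 3 v).N).map (MulAut.conj w₀).toMonoidHom) (hoff : r ∉ Je)
    (hshal : ¬ (Valued.v ((((eA r : ↥(unitaryGroupOfForm (galAdicCompletionMap (L := L) (IsCMField.complexConj L) hw) ((StdForm.antidiagonal 3).over (w.1.adicCompletion L)))) : GL (Fin 3) (w.1.adicCompletion L)) : Matrix (Fin 3) (Fin 3) (w.1.adicCompletion L)) 2 1 /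
          (((eA r : ↥(unitaryGroupOfForm (galAdicCompletionMap (L := L) (IsCMField.complexConj L) hw) ((StdForm.antidiagonal 3).over (w.1.adicCompletion L)))) : GL (Fin 3) (w.1.adicCompletion L)) : Matrix (Fin 3) (Fin 3) (w.1.adicCompletion L)) 2 0) ≤ Valued.v ϖ ^ r₁ ∧
        (Valued.v ϖ ^ s₁)⁻¹ ≤ Valued.v ((((eA r : ↥(unitaryGroupOfForm (galAdicCompletionMap (L := L) (IsCMField.complexConj L) hw) ((StdForm.antidiagonal 3).over (w.1.adicCompletion L)))) : GL (Fin 3) (w.1.adicCompletion L)) : Matrix (Fin 3) (Fin 3) (w.1.adicCompletion L)) 2 0))) :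
    ∃ (b₀ : Gqs L v) (hb₀P : ((r * b₀ * r⁻¹ : Gqs L v) : ↥(unitaryGroupOfForm (conjLocal L (IsCMField.complexConj L) v) (cmLocalForm L 3 v))) ∈ (cmBorelTriple L 3 v).P),
      b₀ ∈ Je ∧
      (if h : IsUnit (((b₀.val : GL (Fin 3) (LocalRing L v)) : Matrix (Fin 3) (Fin 3) (LocalRing L v)) 0 0) then ((χ₁ h.unit : ℂˣ) : ℂ) else 0) ≠
        (haveI := locallyCompactSpace_cmBorelU L 3 v
         (Representation.twist
            (((Representation.trivial ℂ ↥(torusU (conjLocal L (IsCMField.complexConj L) v) (cmLocalForm L 3 v)) ℂ).twist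
              (cmTorusCharPair L v χ₁ 1)).comp (cmBorelTriple L 3 v).proj) (rootDeltaChar (cmBorelTriple L 3 v).P))
          ⟨((r * b₀ * r⁻¹ : Gqs L v) : ↥(unitaryGroupOfForm (conjLocal L (IsCMField.complexConj L) v) (cmLocalForm L 3 v))), hb₀P⟩ 1) := by
  haveI := locallyCompactSpace_cmBorelU L 3 v
  by_cases hz : Valued.v ((((eA r : ↥(unitaryGroupOfForm (galAdicCompletionMap (L := L) (IsCMField.complexConj L) hw) ((StdForm.antidiagonal 3).over (w.1.adicCompletion L)))) :
      GL (Fin 3) (w.1.adicCompletion L)) : Matrix (Fin 3) (Fin 3) (w.1.adicCompletion L)) 2 0) ≤ 1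
  · -- LOWER shells: ★ p862772 verbatim
    exact K2E3TwoDepthDepthWitnessCM.exists_depthWitness_twoDepth_of_mem_map_of_not_mem L v w hw eA heA hϖ r₁ s₁ r₂ s₂ Jg hJg Je hJe w₀ hw₀
      hm hkm hrr hss hr1 hr2 hs1 hs2 hal ht hvt χ₁ hcond u₁ hu₁ hχu₁ u₂ hσu₂ hu₂ hχu₂ hr hz hoff hshal
  -- UPPER shells `|z| > 1`
  rw [not_le] at hz
  have hσσ : ∀ x, (galAdicCompletionMap (L := L) (IsCMField.complexConj L) hw) ((galAdicCompletionMap (L := L) (IsCMField.complexConj L) hw) x) = x :=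
    galAdicCompletionMap_galAdicCompletionMap_of_smul_eq (IsCMField.complexConj L) w (IsCMField.complexConj_ne_one L) hw
  have hvσ : ∀ x, Valued.v (galAdicCompletionMap (L := L) (IsCMField.complexConj L) hw x) = Valued.v x :=
    fun x => valued_galAdicCompletionMap (L := L) (IsCMField.complexConj L) hw x
  have hvϖ1 : Valued.v ϖ ≤ 1 := by rw [hϖ, ← WithZero.exp_zero, WithZero.exp_le_exp]; norm_num
  -- the representative in the place model: `eA r = ū(x, z)`
  have hrw := map_mem_map_of_mem_map L v w hw eA heA (cmBorelTriple L 3 v) rfl w₀ hw₀ hr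
  obtain ⟨x, z, hnb, hrel⟩ := K2E3LowerUnipotentBorelIwahori.exists_coe_eq_lower_of_mem_map _ rfl hσσ hrw
  have e20 : (((eA r : ↥(unitaryGroupOfForm (galAdicCompletionMap (L := L) (IsCMField.complexConj L) hw) ((StdForm.antidiagonal 3).over (w.1.adicCompletion L)))) :
      GL (Fin 3) (w.1.adicCompletion L)) : Matrix (Fin 3) (Fin 3) (w.1.adicCompletion L)) 2 0 = z := by rw [hnb]; rfl
  have e21 : (((eA r : ↥(unitaryGroupOfForm (galAdicCompletionMap (L := L) (IsCMField.complexConj L) hw) ((StdForm.antidiagonal 3).over (w.1.adicCompletion L)))) :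
      GL (Fin 3) (w.1.adicCompletion L)) : Matrix (Fin 3) (Fin 3) (w.1.adicCompletion L)) 2 1 = x := by rw [hnb]; rfl
  rw [e20] at hz
  rw [e20, e21] at hshal
  have hz0 : z ≠ 0 := fun h => by
    rw [h, map_zero] at hz
    exact not_lt_of_ge zero_le_one hz
  -- `r ∉ J_e` in entry form, for free on an upper shell (`|z| > 1 ≥ |ϖ|^{s₂}`)
  have hoffE : ¬ (Valued.v x ≤ Valued.v ϖ ^ r₂ ∧ Valued.v z ≤ Valued.v ϖ ^ s₂) := fun h =>
    not_lt.2 (h.2.trans (pow_le_one' hvϖ1 _)) hz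
  -- the integral point `ū′ = ū(x∕z, z⁻¹) ∈ U(σ_w, Φ₃)(L_w)`
  obtain ⟨nb', hnb'⟩ := exists_coe_eq_lower (galAdicCompletionMap (L := L) (IsCMField.complexConj L) hw)
    (rfl : (StdForm.antidiagonal 3).over (w.1.adicCompletion L) = _) hσσ (K2E3LowerUnipotentBigCellIntegral.div_rel _ hrel hz0)
  -- the swapped two-depth group `J_{e^w}`, `e^w = (r₂, s₂; r₁, s₁)` (Roche's concavity at the swapped tuple from the alignment and `1 ≤ r₂`, `1 ≤ s₂`)
  obtain ⟨Jgw, hJgw'⟩ := K2E3IwahoriTwoDepthFactorisation.exists_subgroup_forall_mem_iff_twoDepth (galAdicCompletionMap (L := L) (IsCMField.complexConj L) hw)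
    (rfl : (StdForm.antidiagonal 3).over (w.1.adicCompletion L) = _) hvσ hϖ (r := r₂) (s := s₂) (r' := r₁) (s' := s₁)
    (by omega) (by omega) (by omega) (by omega)
  have hJgw : ∀ k : ↥(unitaryGroupOfForm (galAdicCompletionMap (L := L) (IsCMField.complexConj L) hw) ((StdForm.antidiagonal 3).over (w.1.adicCompletion L))),
      k ∈ Jgw ↔ ∀ i j, Valued.v (((k : GL (Fin 3) (w.1.adicCompletion L)) : Matrix (Fin 3) (Fin 3) (w.1.adicCompletion L)) i j) ≤
        Valued.v ϖ ^ (![![0, r₁, s₁], ![r₂, 0, r₁], ![s₂, r₂, 0]] : Fin 3 → Fin 3 → ℕ) (Fin.rev i) (Fin.rev j) := fun k => by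
    rw [hJgw' k]
    simp only [K2E3TwoDepthUpperShellCover.twoDepth_rev_apply]
  -- the two exact-conductor constants `c₁ = σ_w((u₁)_w) − 1 ∈ 𝔭ᵐ`, `c₂ = (u₂)_w − 1 ∈ 𝔭ᵏ` (`σ`-fixed)
  set c₁ : w.1.adicCompletion L := galAdicCompletionMap (L := L) (IsCMField.complexConj L) hw ((u₁ : LocalRing L v) w) - 1 with hc₁_def
  set c₂ : w.1.adicCompletion L := (u₂ : LocalRing L v) w - 1 with hc₂_def
  have hc₁ : Valued.v c₁ ≤ Valued.v ϖ ^ m := by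
    rw [hc₁_def, show galAdicCompletionMap (L := L) (IsCMField.complexConj L) hw ((u₁ : LocalRing L v) w) - 1 =
      galAdicCompletionMap (L := L) (IsCMField.complexConj L) hw ((u₁ : LocalRing L v) w - 1) by rw [map_sub, map_one], hvσ]
    exact hu₁ w
  have hσu₂w : galAdicCompletionMap (L := L) (IsCMField.complexConj L) hw ((u₂ : LocalRing L v) w) = (u₂ : LocalRing L v) w := by
    rw [← conjLocal_apply_eq_of_smul_eq (IsCMField.complexConj L) (IsCMField.complexConj_ne_one L) v w hw (u₂ : LocalRing L v)]
    have h := congrArg (fun x : (LocalRing L v)ˣ => (x : LocalRing L v) w) hσu₂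
    simpa only [Units.coe_map, MonoidHom.coe_coe] using h
  have hσc₂ : galAdicCompletionMap (L := L) (IsCMField.complexConj L) hw c₂ = c₂ := by
    rw [hc₂_def, map_sub, map_one, hσu₂w]
  have hc₂ : Valued.v c₂ ≤ Valued.v ϖ ^ k := hu₂ w
  -- ★ p862799: the witness package at `ū′` in the swapped group, `c ∈ {c₁, c₂}`
  obtain ⟨u'', hu''N, hj, c, ε, hc, hε, h00⟩ := K2E3TwoDepthUpperShellCover.exists_upperShell_witness_package
    (galAdicCompletionMap (L := L) (IsCMField.complexConj L) hw) (rfl : (StdForm.antidiagonal 3).over (w.1.adicCompletion L) = _) hσσ hvσ hϖ r₁ s₁ r₂ s₂ Jgw hJgw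
    hm hkm hrr hss hr1 hr2 hs1 hs2 hal hrel hz.le hnb' hoffE hshal hc₁ hσc₂ hc₂ ht hvt
  -- ★ p862901: transport to `r` with the unit `u₁` resp. `u₂`
  rcases hc with rfl | rfl
  · have hcu : galAdicCompletionMap (L := L) (IsCMField.complexConj L) hw (1 + c₁) = (u₁ : LocalRing L v) w := by
      rw [hc₁_def, add_sub_cancel, hσσ]
    exact K2E3TwoDepthUpperShellWitnessCM.exists_upperShellWitness_of_model_of_unit L v w hw eA heA hϖ _ Jg Jgw hJg hJgw Je hJe
      (K2E3IwahoriTwoDepthFactorisation.twoDepth_symm r₁ s₁ r₂ s₂) χ₁ hcond u₁ hχu₁ hnb hrel hz0 hnb' ⟨u'', hu''N, hj, ε, hε, h00⟩ hcu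
  · have hcu : galAdicCompletionMap (L := L) (IsCMField.complexConj L) hw (1 + c₂) = (u₂ : LocalRing L v) w := by
      rw [map_add, map_one, hσc₂, hc₂_def, add_sub_cancel]
    exact K2E3TwoDepthUpperShellWitnessCM.exists_upperShellWitness_of_model_of_unit L v w hw eA heA hϖ _ Jg Jgw hJg hJgw Je hJe
      (K2E3IwahoriTwoDepthFactorisation.twoDepth_symm r₁ s₁ r₂ s₂) χ₁ hcond u₂ hχu₂ hnb hrel hz0 hnb' ⟨u'', hu''N, hj, ε, hε, h00⟩ hcu

end Summit.HodgeConjecture.HodgeConjecture.Cruxes.H413.K2E3BranchAIrreducibleTwoDepthCells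

end
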